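import Literature.NumberTheory.EllipticCurves.HeegnerPointsKolyvaginPrimaryClassesProofs
import Literature.NumberTheory.EllipticCurves.HeegnerPointsKolyvaginPrimaryEulerProofs
import HarnessLib

/-!
# X11b at `p = 3` (team N8/O2), JET3-KUMMER (b), algebraic half: Kolyvagin's roots
# `(γ−1)P_n/p^M` are INTEGRAL combinations of Heegner points (Gross 1991, p. 245)

HONEST FRAMING (cell `b2b-bsdres`, run/shared/lean/b2b/bsd-rank1-residual/, verbatim in every
file): the goal of the cell is to DELETE the COMBINATION-SHAPED residual classes of the
Birch–Swinnerton-Dyer formula for ALL analytic-rank `≤ 1` elliptic curves over `ℚ` — "full BSD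
formula for every rank `≤ 1` curve in class `C`" assembled STRICTLY from published theorems — so
that the rank-`≤ 1` remainder becomes exactly the CONSTRUCTION-SHAPED classes, which are TYPED
(missing-input `Prop`s), NOT attempted. This is not "finishing BSD". Team N8/O2 = `x11b3`, seat
`b2b-bsdres-x11b3-p1`, LEAD DEAL #4/#5 JET3-KUMMER input (b) ("[GZ86, III (3.1)] + Gross's
integrality of `R_σ`"): this file is the ALGEBRAIC half (integrality), the arithmetic half
([GZ86, III (3.1)]: "`y_n` is, up to translation by rational torsion on `E`, in `E⁰`") stays a
cited input (lit1 row L38). THEOREMS ONLY: no definition, no named fact, no `sorry`; nothing is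
booked; the flag `JET@p|N` is NOT discharged here.

## What

Gross 1991, proof of Prop. 6.2 (pp. 244–245): the points `y_n`, `D_n y_n`, `P_n` "lie in a
subgroup `E′` whose image in `φ` has order prime to `p`", and (proof of (2)) the `p`-division
point of `(σ_ℓ − 1)P_n` is the EXPLICIT point "`Q_n = Σ_{σ∈S} σD_m((ℓ+1)/p · y_n − a_ℓ/p · y_m)`";
Jetchev 2008 Lemma 4.2 / harvest-2 E66 (C)(ii) step (b): hence every Kolyvagin root
`R_γ = (γ−1)P_n/p^M` (`γ ∈ 𝒢_n`) lies in `E′` too. The tree proves McCallum's (4),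
`γP_n − P_n ∈ p^M E(K_n)` (`KolyvaginEuler.smul_kolyvaginPoint_sub_mem`, from (3.5)
`(σ_ℓ−1)D_ℓ = ℓ+1−Tr_ℓ`, `p^M ∣ ℓ+1` and `Tr_ℓ y_n ∈ p^M E(K_n)`); this file runs the SAME
computation inside a `𝒢`-stable subgroup `E′ ∋ y_n` with `Tr_ℓ y_n ∈ p^M E′` (printed:
`Tr_ℓ y_n = a_ℓ y_{n/ℓ}`, `y_{n/ℓ} ∈ E′`, `p^M ∣ a_ℓ`):

* `grAct_mem_of_forall_smul_mem` — `ℤ[𝒢]` preserves a `𝒢`-stable subgroup; `smul_mem_map_zsmul`,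
  `grAct_mem_map_zsmul` — and `p^M E′ = E′.map (p^M •)`.
* `smul_grAct_derivProd_sub_mem_map` — Prop. 3.6 inside `E′`:
  `σ_ℓ D_n y − D_n y = D_m((ℓ+1)y − Tr_ℓ y) ∈ p^M E′`.
* **`smul_kolyvaginPoint_sub_mem_map`** — `γP_n − P_n ∈ p^M E′` for every `γ ∈ 𝒢` (the coset
  argument of (4.1) verbatim, with `p^M E′` in place of `p^M E(K_n)`).
* `grAct_traceElt_mem_map_of_eq_smul` — the hypothesis from Prop. 3.7 (1): `Tr_ℓ y = a • y′`,
  `p^M ∣ a`, `y′ ∈ E′` ⇒ `Tr_ℓ y ∈ p^M E′`.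
* **`rootIn_mem_of_exists`** / **`rootIn_smul_sub_mem`** — by uniqueness of `p^M`-th roots in the
  admissible `A = E(K_n)` (McCallum (5), `KolyvaginCocycle.rootIn_eq`), the root
  `rootIn A n (γP − P)` used by McCallum's cocycle IS the element of `E′` so produced: the values
  `(γ−1)P_n/p^M` of the cocycle `σ ↦ −(σ−1)P_n/p^M` representing `d(n)` lie in `E′` — the
  hypothesis `hval` of `Three/KolyvaginClassBadPlace.lean` (`…_of_mem_of_zsmul_mem`) and input (b)
  of `Three/JetchevKummerAtP.lean` (`n′R_σ ∈ E₀`), modulo [GZ86 III (3.1)] which supplies `E′`.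

References (locators only; no cited FACT): [cite: GrossLMS1991, §3 (3.5), Prop. 3.6, §4 (4.1),
Prop. 6.2 (proof, pp. 244–245)] [cite: McCallumLMS1991, §4 (4)–(5), Lemma 4.1]
[cite: Jetchev2008, Lemma 4.2 (p. 820), Prop. 4.1 (p. 819)].
-/

noncomputable section

open Finset

namespace Summit.BirchSwinnertonDyer.Rank1Residual.X11b.Three.KolyvaginRoot

open Literature.NumberTheory.EllipticCurves Literature.NumberTheory.EllipticCurves.KolyvaginEuler
  Literature.NumberTheory.EllipticCurves.KolyvaginCocycle

/-! ### §1 `ℤ[𝒢]` and `p^M E′` for a `𝒢`-stable subgroup `E′` -/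

section GroupRing

variable {𝒢 : Type*} [CommGroup 𝒢] {A : Type*} [AddCommGroup A] [DistribMulAction 𝒢 A]
  {E' : AddSubgroup A} (hE : ∀ (g : 𝒢), ∀ e ∈ E', g • e ∈ E') {n : ℤ}

include hE in
/-- The group ring `ℤ[𝒢]` preserves every `𝒢`-stable subgroup (`(Σ c_γ γ) e = Σ c_γ γe`).
[folklore] -/
theorem grAct_mem_of_forall_smul_mem (r : MonoidAlgebra ℤ 𝒢) {x : A} (hx : x ∈ E') :
    grAct A r x ∈ E' := by
  induction r using MonoidAlgebra.induction_on with
  | hM g => rw [grAct_of]; exact hE g x hx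
  | hadd f g hf hg => rw [grAct_add]; exact E'.add_mem hf hg
  | hsmul c f hf => rw [grAct_smul]; exact E'.zsmul_mem hf c

include hE in
/-- `n E′` is `𝒢`-stable when `E′` is. [folklore] -/
theorem smul_mem_map_zsmul (g : 𝒢) {x : A} (hx : x ∈ E'.map (zsmulAddGroupHom n : A →+ A)) :
    g • x ∈ E'.map (zsmulAddGroupHom n : A →+ A) := by
  obtain ⟨e, he, rfl⟩ := hx
  exact ⟨g • e, hE g e he, (map_zsmul (DistribSMul.toAddMonoidHom A g) n e).symm⟩

include hE in
/-- `ℤ[𝒢]` preserves `n E′`. [folklore] -/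
theorem grAct_mem_map_zsmul (r : MonoidAlgebra ℤ 𝒢) {x : A}
    (hx : x ∈ E'.map (zsmulAddGroupHom n : A →+ A)) :
    grAct A r x ∈ E'.map (zsmulAddGroupHom n : A →+ A) := by
  obtain ⟨e, he, rfl⟩ := hx
  exact ⟨grAct A r e, grAct_mem_of_forall_smul_mem hE r he,
    by rw [zsmulAddGroupHom_apply, zsmulAddGroupHom_apply, grAct_zsmul]⟩

/-- From Prop. 3.7 (1) to the hypothesis inside `E′`: if `Tr_ℓ y = a • y′` with `n ∣ a` and
`y′ ∈ E′` (printed: `Tr_ℓ y_n = a_ℓ y_{n/ℓ}`, `p^M ∣ a_ℓ`, `y_{n/ℓ} ∈ E′`), then `Tr_ℓ y ∈ n E′`.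
[cite: GrossLMS1991, Prop. 3.7 (1), (3.3)] -/
theorem grAct_traceElt_mem_map_of_eq_smul {σ : 𝒢} {ℓ : ℕ} {a : ℤ} {y y' : A}
    (hrel : grAct A (traceElt σ ℓ) y = a • y') (ha : n ∣ a) (hy' : y' ∈ E') :
    grAct A (traceElt σ ℓ) y ∈ E'.map (zsmulAddGroupHom n : A →+ A) := by
  obtain ⟨k, rfl⟩ := ha
  exact ⟨k • y', E'.zsmul_mem hy' k, by rw [zsmulAddGroupHom_apply, ← mul_smul, hrel]⟩

include hE in
/-- **Prop. 3.6 inside `E′`**: if `σ_ℓ^{ℓ+1} = 1`, `n ∣ ℓ+1`, `y ∈ E′` and `Tr_ℓ y ∈ n E′` for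
`ℓ ∈ L`, then `σ_ℓ D_n y − D_n y = D_m((ℓ+1)y − Tr_ℓ y) ∈ n E′` — the tree's
`smul_grAct_derivProd_sub_mem` with `n E(K_n)` replaced by `n E′`. [cite: GrossLMS1991, Prop. 3.6]
[cite: McCallumLMS1991, §4 (4)] -/
theorem smul_grAct_derivProd_sub_mem_map {σ : ℕ → 𝒢} {L : Finset ℕ}
    (hord : ∀ ℓ ∈ L, σ ℓ ^ (ℓ + 1) = 1) (hdvd : ∀ ℓ ∈ L, n ∣ ((ℓ + 1 : ℕ) : ℤ)) {y : A}
    (hy : y ∈ E')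
    (htr : ∀ ℓ ∈ L, grAct A (traceElt (σ ℓ) ℓ) y ∈ E'.map (zsmulAddGroupHom n : A →+ A))
    {ℓ : ℕ} (hℓ : ℓ ∈ L) :
    σ ℓ • grAct A (derivProd σ L) y - grAct A (derivProd σ L) y ∈
      E'.map (zsmulAddGroupHom n : A →+ A) := by
  have : σ ℓ • grAct A (derivProd σ L) y - grAct A (derivProd σ L) y =
      grAct A ((MonoidAlgebra.of ℤ 𝒢 (σ ℓ) - 1) * derivProd σ L) y := by
    rw [sub_mul, one_mul, grAct_sub, smul_grAct]
  rw [this, of_sub_one_mul_derivProd hℓ (hord ℓ hℓ), grAct_mul]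
  apply grAct_mem_map_zsmul hE
  rw [grAct_sub, grAct_natCast]
  refine (E'.map _).sub_mem ?_ (htr ℓ hℓ)
  obtain ⟨k, hk⟩ := hdvd ℓ hℓ
  exact ⟨k • y, E'.zsmul_mem hy k, by
    rw [zsmulAddGroupHom_apply, ← mul_smul, ← hk, natCast_zsmul]⟩

include hE in
/-- **Integrality of Kolyvagin's roots** (Gross 1991 p. 245 "`Q_n = Σ_{σ∈S} σD_m((ℓ+1)/p·y_n −
a_ℓ/p·y_m)`"; McCallum (4) inside `E′`): for `P_n = Σ_{s∈S} s D_n y` with `G_n = ⟨σ_ℓ : ℓ ∈ L⟩`,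
`σ_ℓ^{ℓ+1} = 1`, `n ∣ ℓ+1`, `y ∈ E′` (`𝒢`-stable) and `Tr_ℓ y ∈ n E′`:
**`γP_n − P_n ∈ n E′` for every `γ ∈ 𝒢`** — so the `n`-th root of `(γ−1)P_n` may be taken in
`E′`. [cite: GrossLMS1991, §4 (4.1), Prop. 6.2 (proof, p. 245)] [cite: McCallumLMS1991, §4 (4)] -/
theorem smul_kolyvaginPoint_sub_mem_map {σ : ℕ → 𝒢} {L : Finset ℕ} {H : Subgroup 𝒢}
    [Fintype (𝒢 ⧸ H)] {f : 𝒢 ⧸ H → 𝒢} (hf : ∀ q, (f q : 𝒢 ⧸ H) = q)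
    (hgen : H ≤ Subgroup.closure (σ '' (L : Set ℕ)))
    (hord : ∀ ℓ ∈ L, σ ℓ ^ (ℓ + 1) = 1) (hdvd : ∀ ℓ ∈ L, n ∣ ((ℓ + 1 : ℕ) : ℤ)) {y : A}
    (hy : y ∈ E')
    (htr : ∀ ℓ ∈ L, grAct A (traceElt (σ ℓ) ℓ) y ∈ E'.map (zsmulAddGroupHom n : A →+ A))
    (γ : 𝒢) :
    γ • kolyvaginPoint σ L f y - kolyvaginPoint σ L f y ∈
      E'.map (zsmulAddGroupHom n : A →+ A) := by
  unfold kolyvaginPoint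
  refine smul_sum_smul_sub_mem H (fun g b hb ↦ smul_mem_map_zsmul hE g hb) (fun h hh ↦ ?_) f hf γ
  refine smul_sub_mem_of_mem_closure (fun g b hb ↦ smul_mem_map_zsmul hE g hb) ?_ (hgen hh)
  rintro _ ⟨ℓ, hℓ, rfl⟩
  exact smul_grAct_derivProd_sub_mem_map hE hord hdvd hy htr hℓ

include hE in
/-- `P_n` itself lies in `E′` (`E′` is `𝒢`-stable and `ℤ[𝒢] E′ ⊆ E′`). [folklore] -/
theorem kolyvaginPoint_mem {σ : ℕ → 𝒢} {L : Finset ℕ} {H : Subgroup 𝒢} [Fintype (𝒢 ⧸ H)]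
    (f : 𝒢 ⧸ H → 𝒢) {y : A} (hy : y ∈ E') : kolyvaginPoint σ L f y ∈ E' := by
  unfold kolyvaginPoint
  exact E'.sum_mem fun q _ ↦ hE _ _ (grAct_mem_of_forall_smul_mem hE _ hy)

end GroupRing

/-! ### §2 The root used by McCallum's cocycle lies in `E′` -/

section Root

variable {G : Type*} [Group G] {M : Type*} [AddCommGroup M] [DistribMulAction G M]
  {A : AddSubgroup M} {n : ℤ}

/-- **Uniqueness transfers integrality to `rootIn`**: if `x` has SOME `n`-th root in `E′ ∩ A`,
then the root `rootIn A n x` chosen by McCallum's cocycle (unique, `A` being `n`-torsion-free: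
McCallum (5) "`E` has no `K_n`-rational `p`-torsion") lies in `E′`. [cite: McCallumLMS1991, §4 (5),
Lemma 4.1] -/
theorem rootIn_mem_of_exists (hA : IsAdmissible G A n) {E' : AddSubgroup M} {x : M}
    (h : ∃ R ∈ E', R ∈ A ∧ n • R = x) : rootIn A n x ∈ E' := by
  obtain ⟨R, hRE, hRA, hRx⟩ := h
  rw [rootIn_eq hA.eq_zero_of_zsmul hRA hRx]
  exact hRE

/-- **The values of the cocycle `σ ↦ −(σ−1)P/n` lie in `E′`** whenever `gP − P ∈ n(E′ ∩ A)`: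
the hypothesis `hval` of `Three/KolyvaginClassBadPlace.lean` / input (b) of
`Three/JetchevKummerAtP.lean`, reduced to "`γP_n − P_n ∈ p^M E′`"
(`smul_kolyvaginPoint_sub_mem_map`) plus [GZ86 III (3.1)] for the choice of `E′`.
[cite: GrossLMS1991, Prop. 6.2 (proof, pp. 244–245)] [cite: Jetchev2008, Lemma 4.2 (p. 820)] -/
theorem rootIn_smul_sub_mem (hA : IsAdmissible G A n) {E' : AddSubgroup M} (hE'A : E' ≤ A)
    {P : M} (g : G) (h : g • P - P ∈ E'.map (zsmulAddGroupHom n : M →+ M)) :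
    rootIn A n (g • P - P) ∈ E' := by
  obtain ⟨R, hR, hRx⟩ := h
  exact rootIn_mem_of_exists hA ⟨R, hR, hE'A hR, hRx⟩

end Root

end Summit.BirchSwinnertonDyer.Rank1Residual.X11b.Three.KolyvaginRoot

end
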